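import Summits.BirchSwinnertonDyer.Rank1Residual.X11b.LocalH2Transition
import Literature.NumberTheory.GaloisRepresentations.ContinuousCohomologyNineTerm
import Literature.NumberTheory.GaloisRepresentations.LocalFieldCdTwo
import HarnessLib

/-!
# X11b, route R1 — the transition maps `H²(K_v, E[p^a]) → H²(K_v, E[p^a·p^b])` VANISH at EVERY
# finite place (also `v ∣ p`) as soon as `E(K_v)[p^a p^b] = E(K_v)[p^b]` (towards (L10))

HONEST FRAMING (cell `b2b-bsdres`, run/shared/lean/b2b/bsd-rank1-residual/, verbatim in every
file): the goal of the cell is to DELETE the COMBINATION-SHAPED residual classes of the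
Birch–Swinnerton-Dyer formula for ALL analytic-rank `≤ 1` elliptic curves over `ℚ` — "full BSD
formula for every rank `≤ 1` curve in class `C`" assembled STRICTLY from published theorems — so
that the rank-`≤ 1` remainder becomes exactly the CONSTRUCTION-SHAPED classes, which are TYPED
(missing-input `Prop`s), NOT attempted. This is not "finishing BSD". Sub-cell
`b2b-bsdres-multr1-p1` (X11b, route R1 = Castella 2018 Thm. A re-proved along the author's
erratum); a RESEARCH ROUTE; no claim beyond the stated class; X11b stays CONSTRUCTION-SHAPED;
nothing here changes a label; no named fact is minted (theorems only; no `sorry`).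

## What this file does

JSW17 Lemma 3.3.3 uses "the local cohomology group `H²(K_w, W)` is dual to `H⁰(K_w, T)`, and the
latter is `0`" at EVERY place `w` (also `w ∣ p`).  At finite level this is the vanishing of the
transition maps of the direct system `(H²(K_v, E[p^k]))_k`.  The sibling `LocalH2Transition.lean`
(gen 15) proves it at `v ∤ p` by an Euler-characteristic count (Milne I 2.8).  Here a SHORTER and
UNIFORM argument, valid at every finite place of a number field (indeed over any `K`-algebra that is
a non-archimedean local field of characteristic `0`), from results PROVED in the tree:

* `cd_p(Γ_F) ≤ 2` (`LocalFieldCdTwo.subsingleton_continuousCohomology_of_two_lt`), whence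
  `H²(F, E[p^a p^b]) → H²(F, E[p^b])` is ONTO along `0 → E[p^a] → E[p^a p^b] →[p^a] E[p^b] → 0`
  (`IsSES.exists_map_two_eq_of_subsingleton_three`, `ContinuousCohomologyNineTerm`);
* local duality in bidegree `(2,0)` + Weil: `#H²(F, E[n]) = #E(F)[n]`
  (`natCard_galoisCohomology_two_torsion_restrictField`, `LocalEulerCharacteristicTorsion`);

so `#ker(H²(E[p^a p^b]) → H²(E[p^b])) = #E(F)[p^a p^b] / #E(F)[p^b]`, which is `1` as soon as
`#E(F)[p^a p^b] = #E(F)[p^b]` (e.g. `p^b ⊇` the `p`-primary torsion of `E(F)`), and the transition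
`H²(F, E[p^a]) → H²(F, E[p^a p^b])` lands in that kernel (`IsSES.map_two_map_two`):

* `map_two_torsionInclusion_eq_zero_of_card_eq` — the transition vanishes for EVERY `a ≥ 1`;
* `map_two_torsionInclusion_eq_zero_of_exponent` — the same from a uniform `p`-power exponent
  `p^e E(F)[p^∞] = 0` and `e ≤ b`.

References: [JetchevSkinnerWan2017] §2.2.2 and Lemma 3.3.3 (arXiv:1512.06894 pp. 6, 12);
[SerreGaloisCohomology1997] II §4.3 Prop. 12, II §5.2 Thm. 2; [MilneADT2006] I Cor. 2.3.
-/

noncomputable section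

open scoped Classical

open CategoryTheory Field NumberField IsDedekindDomain
open Literature.NumberTheory.EllipticCurves
open Literature.NumberTheory.GaloisRepresentations
open scoped ContRepresentation

universe u

-- `H²` needs `LocallyCompactSpace Γ`; compactness of absolute Galois groups as a local instance.
attribute [local instance] absoluteGaloisGroup_compactSpace

namespace Summit.BirchSwinnertonDyer.Rank1Residual.X11b.Levels

/-! ## The vanishing of the transition maps -/

section Local

variable {K : Type u} [Field K] [NumberField K] (W : WeierstrassCurve K) [W.IsElliptic]
  (p : ℕ) [Fact p.Prime]
  (F : Type u) [Field F] [Algebra K F] [CharZero F] [ValuativeRel F] [TopologicalSpace F]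
  [IsNonarchimedeanLocalField F]

/-- **The transition `H²(F, E[p^a]) → H²(F, E[p^a·p^b])` is ZERO whenever
`#E(F)[p^a p^b] = #E(F)[p^b]`** (`a, b ≥ 1`; `F` a non-archimedean local field of characteristic
`0` over `K`, e.g. `K_v` at ANY finite place): the image lies in the kernel of
`H²(F, E[p^a p^b]) →[p^a] H²(F, E[p^b])`, which is onto (`cd_p(Γ_F) ≤ 2`) between groups of orders
`#E(F)[p^a p^b]` and `#E(F)[p^b]` (local duality `(2,0)` + Weil), hence trivial.
[cite: JetchevSkinnerWan2017, §2.2.2 and Lemma 3.3.3 (arXiv:1512.06894 pp. 6, 12)]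
[cite: SerreGaloisCohomology1997, II §4.3 Prop. 12 and II §5.2 Thm. 2] -/
theorem map_two_torsionInclusion_eq_zero_of_card_eq {a b : ℕ} (ha0 : a ≠ 0) (hb0 : b ≠ 0)
    (hcard : Nat.card (nsmulAddMonoidHom (p ^ a * p ^ b) : (W.baseChange F).toAffine.Point →+ _).ker
      = Nat.card (nsmulAddMonoidHom (p ^ b) : (W.baseChange F).toAffine.Point →+ _).ker)
    (z : galoisCohomology (GaloisRep.restrictField F (W.torsionGaloisModule ((p ^ a : ℕ) : ℤ))) 2) :
    galoisCohomology.map ((W.torsionInclusion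
      (Dvd.intro ((p ^ b : ℕ) : ℤ) rfl : ((p ^ a : ℕ) : ℤ) ∣ ((p ^ a : ℕ) : ℤ) * ((p ^ b : ℕ) : ℤ)))
        |>.restrictField F) 2 z = 0 := by
  have hprime : p.Prime := Fact.out
  have hka : ((p ^ a : ℕ) : ℤ) ≠ 0 := by exact_mod_cast pow_ne_zero a hprime.ne_zero
  have hses := (W.torsion_isSES hka ((p ^ b : ℕ) : ℤ)).restrictField F
  haveI : NeZero (p ^ a) := ⟨pow_ne_zero a hprime.ne_zero⟩
  haveI : NeZero (p ^ b) := ⟨pow_ne_zero b hprime.ne_zero⟩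
  haveI : NeZero (p ^ a * p ^ b) :=
    ⟨mul_ne_zero (pow_ne_zero a hprime.ne_zero) (pow_ne_zero b hprime.ne_zero)⟩
  have hab : p ^ a * p ^ b = p ^ (a + b) := (pow_add p a b).symm
  have hppa : IsPrimePow (p ^ a) := hprime.isPrimePow.pow ha0
  have hppb : IsPrimePow (p ^ b) := hprime.isPrimePow.pow hb0
  have hppab : IsPrimePow (p ^ a * p ^ b) := by
    rw [hab]; exact hprime.isPrimePow.pow (by omega)
  -- `H³(F, E[p^a]) = 0` (`cd_p(Γ_F) ≤ 2`), hence `H²([p^a])` is onto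
  haveI : Subsingleton (continuousCohomology 3 (DiscreteGaloisModule.toTopRep
      (GaloisRep.restrictField F (W.torsionGaloisModule ((p ^ a : ℕ) : ℤ))))) :=
    subsingleton_continuousCohomology_of_two_lt F (p := p) _
      (fun T ↦ ⟨a, Subtype.ext (by
        have hT := (W.mem_geomTorsion_iff _ _).mp T.2
        rw [natCast_zsmul] at hT
        simpa only [AddSubmonoidClass.coe_nsmul, ZeroMemClass.coe_zero] using hT)⟩)
      (by norm_num)
  -- the two cardinalities
  have h2 := natCard_galoisCohomology_two_torsion_restrictField W F (p ^ a * p ^ b) hppab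
  rw [Nat.cast_mul] at h2
  have h3 := natCard_galoisCohomology_two_torsion_restrictField W F (p ^ b) hppb
  haveI := h2.1
  haveI := h3.1
  -- the surjection `g₂ = H²([p^a]) : H²(E[p^a p^b]) → H²(E[p^b])` as an additive map
  set g₂ := galoisCohomology.map ((W.torsionMulBy ((p ^ a : ℕ) : ℤ) ((p ^ b : ℕ) : ℤ)).restrictField F) 2
    with hg₂
  have hsurj : Function.Surjective g₂ := fun x ↦ hses.exists_map_two_eq_of_subsingleton_three x
  -- its kernel is trivial by counting
  have hker : Nat.card g₂.ker = 1 := by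
    have hc := natCard_eq_card_ker_mul_card_range g₂
    rw [AddMonoidHom.range_eq_top.mpr hsurj, AddSubgroup.card_top, h2.2, h3.2, hcard] at hc
    haveI : Finite (nsmulAddMonoidHom (p ^ b) : (W.baseChange F).toAffine.Point →+ _).ker :=
      Nat.finite_of_card_ne_zero (by rw [← h3.2]; exact Nat.card_pos.ne')
    have hpos : 0 < Nat.card (nsmulAddMonoidHom (p ^ b) : (W.baseChange F).toAffine.Point →+ _).ker :=
      Nat.card_pos
    nth_rw 1 [← one_mul (Nat.card _)] at hc
    exact (Nat.eq_of_mul_eq_mul_right hpos hc).symm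
  have hbot : g₂.ker = ⊥ := AddSubgroup.eq_bot_of_card_eq _ hker
  -- the transition lands in `ker g₂`
  have hmem : galoisCohomology.map ((W.torsionInclusion
      (Dvd.intro ((p ^ b : ℕ) : ℤ) rfl : ((p ^ a : ℕ) : ℤ) ∣ ((p ^ a : ℕ) : ℤ) * ((p ^ b : ℕ) : ℤ)))
        |>.restrictField F) 2 z ∈ g₂.ker := by
    rw [AddMonoidHom.mem_ker, hg₂]
    exact hses.map_two_map_two z
  rw [hbot, AddSubgroup.mem_bot] at hmem
  exact hmem

/-- **The same from a uniform `p`-power exponent of `E(F)`**: if `p^e` kills every `p`-power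
torsion point of `E(F)` and `e ≤ b`, then `E(F)[p^a p^b] = E(F)[p^b]`, so the transition
`H²(F, E[p^a]) → H²(F, E[p^a·p^b])` vanishes for every `a ≥ 1`.
[cite: JetchevSkinnerWan2017, §2.2.2 and Lemma 3.3.3 (arXiv:1512.06894 pp. 6, 12)] -/
theorem map_two_torsionInclusion_eq_zero_of_exponent {e a b : ℕ} (ha0 : a ≠ 0) (hb0 : b ≠ 0)
    (hb : e ≤ b)
    (he : ∀ (j : ℕ) (Q : (W.baseChange F).toAffine.Point), p ^ j • Q = 0 → p ^ e • Q = 0)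
    (z : galoisCohomology (GaloisRep.restrictField F (W.torsionGaloisModule ((p ^ a : ℕ) : ℤ))) 2) :
    galoisCohomology.map ((W.torsionInclusion
      (Dvd.intro ((p ^ b : ℕ) : ℤ) rfl : ((p ^ a : ℕ) : ℤ) ∣ ((p ^ a : ℕ) : ℤ) * ((p ^ b : ℕ) : ℤ)))
        |>.restrictField F) 2 z = 0 := by
  refine map_two_torsionInclusion_eq_zero_of_card_eq W p F ha0 hb0 (congrArg Nat.card ?_) z
  -- the two kernels coincide as subgroups
  have hpb : ∀ Q : (W.baseChange F).toAffine.Point, p ^ e • Q = 0 → p ^ b • Q = 0 := fun Q hQ ↦ by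
    rw [← pow_mul_pow_sub p hb, mul_comm, mul_smul, hQ, smul_zero]
  congr 1
  ext Q
  simp only [AddMonoidHom.mem_ker, nsmulAddMonoidHom_apply]
  constructor
  · intro hQ
    exact hpb Q (he (a + b) Q (by rw [pow_add]; exact hQ))
  · intro hQ
    rw [mul_smul, hQ, smul_zero]

end Local

end Summit.BirchSwinnertonDyer.Rank1Residual.X11b.Levels

end
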